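import Mathlib
import Literature.Probability.Percolation.DiagonalStripVertexReflection
import HarnessLib

/-!
# The parity symmetry of Hagendorf–Liénardy's vector and the left reflection relation

Topic `Literature/Probability/Percolation`. Hagendorf–Liénardy establish the *left* reflection relation
(their (3.27)) through a second vector `Ψ̄` (Prop. 3.8). We obtain it instead from the *right*
reflection relation (`DiagonalStripVertexReflection`) of the vector of the complementary sector through
the **parity symmetry** `Θ` = site reversal ∘ spin reversal combined with the substitution
`ỹ : z_k ↦ 1/z_{L+1-k}` (**`yHom`**): the vector `V_σ = ỹ(Ψ'_{Θσ})`, `Ψ'` the vector of the sector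
with `L - n` down spins, satisfies the same exchange relations as the vector `Ψ` of the sector with
`n` down spins (**`isHLExchange_yHom_theta`**), its special component is `± (∏_j z_j) Ψ_{σ⁰}`
(**`yHom_vPsi_spec`**), hence `Ψ = ± (∏_j z_j)⁻¹ V` by the uniqueness of HL Prop. 3.5
(**`vPsiVec_eq_theta`**), and the right reflection relations for `Ψ'` become the **left reflection
relations** for `Ψ`: `ι_1 Ψ_σ = z_1² Ψ_σ` if the first spin is down, `ι_1 Ψ_σ = Ψ_σ` if it is up
(**`genInv_one_vPsiVec`**; HL (3.37)–(3.38) at `β → 0`).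

## References

* C. Hagendorf, J. Liénardy, *The open XXZ chain at Δ = -1/2 and the boundary quantum
  Knizhnik–Zamolodchikov equations*, J. Stat. Mech. (2021) 013104, arXiv:2008.03220, Prop. 3.5,
  Prop. 3.7, Prop. 3.8, (3.36)–(3.38). [HagendorfLienardy2021]
-/

noncomputable section

namespace Literature.Probability.Percolation

open Finset MvPolynomial Literature.Probability.LatticeModels.TemperleyLieb

variable {L n : ℕ}

/-! ### The substitution `ỹ : z_k ↦ 1/z_{L+1-k}` -/

section YHom

/-- The reversal of `1, …, L` as a permutation of `ℕ`. [folklore] -/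
def revPerm (L : ℕ) : Equiv.Perm ℕ where
  toFun k := if 1 ≤ k ∧ k ≤ L then L + 1 - k else k
  invFun k := if 1 ≤ k ∧ k ≤ L then L + 1 - k else k
  left_inv k := by
    by_cases h : 1 ≤ k ∧ k ≤ L
    · simp only [h, and_self, if_true]
      rw [if_pos (by omega)]; omega
    · simp only [h, if_false]
  right_inv k := by
    by_cases h : 1 ≤ k ∧ k ≤ L
    · simp only [h, and_self, if_true]
      rw [if_pos (by omega)]; omega
    · simp only [h, if_false]

/-- The reversal on an index. [folklore] -/
theorem revPerm_apply (L k : ℕ) : revPerm L k = if 1 ≤ k ∧ k ≤ L then L + 1 - k else k := rfl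

/-- **The site reversal `z_k ↦ z_{L+1-k}`** on the rapidity field. [folklore] -/
def genRev (L : ℕ) : RapidityField ℂ ≃+* RapidityField ℂ :=
  IsFractionRing.ringEquivOfRingEquiv (renameEquiv ℂ (revPerm L)).toRingEquiv

/-- The reversal on polynomials. [folklore] -/
theorem genRev_toRF (L : ℕ) (P : MvPolynomial ℕ ℂ) : genRev L (toRF ℂ P) = toRF ℂ (rename (revPerm L) P) :=
  IsFractionRing.ringEquivOfRingEquiv_algebraMap _ P

/-- The reversal on the generators. [folklore] -/
theorem genRev_genZ (L k : ℕ) : genRev L (genZ ℂ k) = genZ ℂ (revPerm L k) := by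
  unfold genZ; rw [genRev_toRF, rename_X]

/-- The reversal fixes the constants. [folklore] -/
theorem genRev_genC (L : ℕ) (a : ℂ) : genRev L (genC ℂ a) = genC ℂ a := by
  unfold genC; rw [genRev_toRF, rename_C]

/-- **The substitution `ỹ`**: `z_k ↦ 1/z_{L+1-k}` for `1 ≤ k ≤ L`. [cite: HagendorfLienardy2021, (3.20)] -/
def yHom (L : ℕ) : RapidityField ℂ →+* RapidityField ℂ := (genInvAll ℂ L).comp (genRev L).toRingHom

/-- `ỹ` fixes the constants. [folklore] -/
@[simp] theorem yHom_genC (L : ℕ) (a : ℂ) : yHom L (genC ℂ a) = genC ℂ a := by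
  simp [yHom, genRev_genC, genInvAll_genC]

/-- `ỹ` on the generators. [folklore] -/
theorem yHom_genZ (L k : ℕ) : yHom L (genZ ℂ k) = if 1 ≤ k ∧ k ≤ L then (genZ ℂ (L + 1 - k))⁻¹ else genZ ℂ k := by
  simp only [yHom, RingHom.comp_apply, RingEquiv.toRingHom_eq_coe, RingHom.coe_coe, genRev_genZ, revPerm_apply, genInvAll_genZ]
  by_cases h : 1 ≤ k ∧ k ≤ L
  · rw [if_pos h, if_pos (by omega), if_pos h]
  · rw [if_neg h, if_neg h, if_neg h]

/-- **`ỹ` on the site rapidities**: `ỹ(z_j) = 1/z_{rev j}`. [cite: HagendorfLienardy2021, (3.20)] -/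
theorem yHom_zv (j : Fin L) : yHom L (zv j) = (zv (Fin.rev j))⁻¹ := by
  unfold zv
  rw [yHom_genZ, if_pos ⟨by omega, j.isLt⟩, Fin.val_rev]
  congr 2; omega

/-- `ỹ` commutes with `t ↦ [t]`. [folklore] -/
theorem yHom_qbr (L : ℕ) (x : RapidityField ℂ) : yHom L (qbr x) = qbr (yHom L x) := map_qbr _ x

/-- **`ỹ` intertwines the swaps**: `σ_i ∘ ỹ = ỹ ∘ σ_{L-i}`. [folklore] -/
theorem genSwap_yHom {i : ℕ} (hi : 1 ≤ i) (hiL : i + 1 ≤ L) (x : RapidityField ℂ) :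
    genSwap ℂ i (yHom L x) = yHom L (genSwap ℂ (L - i) x) := by
  have : (genSwap ℂ i).toRingHom.comp (yHom L) = (yHom L).comp (genSwap ℂ (L - i)).toRingHom := by
    refine rapidityField_ringHom_ext (fun a => ?_) (fun k => ?_)
    · simp [genSwap_genC]
    · simp only [RingHom.comp_apply, RingEquiv.toRingHom_eq_coe, RingHom.coe_coe]
      by_cases h1 : k = L - i
      · subst h1
        rw [genSwap_genZ, zswap_self, yHom_genZ, if_pos (by omega), yHom_genZ, if_pos (by omega), map_inv₀, genSwap_genZ,
          show L + 1 - (L - i) = i + 1 by omega, zswap_succ, show L + 1 - (L - i + 1) = i by omega]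
      · by_cases h2 : k = L - i + 1
        · subst h2
          rw [genSwap_genZ, zswap_succ, yHom_genZ, if_pos (by omega), yHom_genZ, if_pos (by omega), map_inv₀, genSwap_genZ,
            show L + 1 - (L - i + 1) = i by omega, zswap_self, show L + 1 - (L - i) = i + 1 by omega]
        · rw [genSwap_genZ, zswap_of_ne _ h1 h2, yHom_genZ]
          by_cases h3 : 1 ≤ k ∧ k ≤ L
          · rw [if_pos h3, map_inv₀, genSwap_genZ, zswap_of_ne _ (by omega) (by omega)]
          · rw [if_neg h3, genSwap_genZ, zswap_of_ne _ (by omega) (by omega)]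
  exact congrArg (fun f => f x) (congrArg DFunLike.coe this)

/-- **`ỹ` intertwines the two inversions**: `ι_1 ∘ ỹ = ỹ ∘ ι_L`. [folklore] -/
theorem genInv_one_yHom (hL : 1 ≤ L) (x : RapidityField ℂ) : genInv ℂ 1 (yHom L x) = yHom L (genInv ℂ L x) := by
  have : (genInv ℂ 1).comp (yHom L) = (yHom L).comp (genInv ℂ L) := by
    refine rapidityField_ringHom_ext (fun a => ?_) (fun k => ?_)
    · simp [genInv_genC]
    · simp only [RingHom.comp_apply]
      by_cases h1 : k = L
      · subst h1
        rw [yHom_genZ, if_pos ⟨hL, le_rfl⟩, map_inv₀, genInv_genZ, show k + 1 - k = 1 by omega, Function.update_self, inv_inv,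
          genInv_genZ, Function.update_self, map_inv₀, yHom_genZ, if_pos ⟨hL, le_rfl⟩, show k + 1 - k = 1 by omega, inv_inv]
      · rw [genInv_genZ, Function.update_of_ne h1, yHom_genZ]
        by_cases h3 : 1 ≤ k ∧ k ≤ L
        · rw [if_pos h3, map_inv₀, genInv_genZ, Function.update_of_ne (by omega)]
        · rw [if_neg h3, genInv_genZ, Function.update_of_ne (by omega)]
  exact congrArg (fun f => f x) (congrArg DFunLike.coe this)

end YHom

/-! ### The parity map on configurations -/

section Theta

/-- **The parity map** `Θ`: site reversal followed by spin reversal. [cite: HagendorfLienardy2021, §3.3] -/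
def thetaConf (σ : SpinConfig L) : SpinConfig L := fun j => !σ (Fin.rev j)

/-- The parity map on a site. [folklore] -/
@[simp] theorem thetaConf_apply (σ : SpinConfig L) (j : Fin L) : thetaConf σ j = !σ (Fin.rev j) := rfl

/-- The parity map exchanges the sectors `n` and `L - n`. [folklore] -/
theorem downCount_thetaConf (σ : SpinConfig L) : downCount (thetaConf σ) + downCount σ = L := by
  unfold downCount
  have h1 : (univ.filter fun j : Fin L => thetaConf σ j = true) = (univ.filter fun j : Fin L => σ j = false).map Fin.revPerm.toEmbedding := by
    ext j
    simp only [mem_filter, mem_univ, true_and, thetaConf_apply, Bool.not_eq_true', mem_map, Equiv.toEmbedding_apply, Fin.revPerm_apply]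
    constructor
    · intro h; exact ⟨Fin.rev j, h, Fin.rev_rev j⟩
    · rintro ⟨i, hi, rfl⟩; rw [Fin.rev_rev]; exact hi
  rw [h1, card_map]
  have := Finset.card_filter_add_card_filter_not (s := (univ : Finset (Fin L))) (fun j => σ j = false)
  simp only [card_univ, Fintype.card_fin] at this
  convert this using 2
  exact congrArg _ (filter_congr fun j _ => by cases σ j <;> simp)

/-- The parity map and a move. [folklore] -/
theorem thetaConf_spinFlip {s t : Fin L} (hst : s ≠ t) (σ : SpinConfig L) :
    thetaConf (spinFlip s t σ) = spinFlip (Fin.rev t) (Fin.rev s) (thetaConf σ) := by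
  have hst' : Fin.rev t ≠ Fin.rev s := fun h => hst (Fin.rev_injective h).symm
  funext j
  simp only [thetaConf_apply]
  by_cases h1 : j = Fin.rev t
  · subst h1; rw [spinFlip_apply_left hst', Fin.rev_rev, spinFlip_apply_right, thetaConf_apply, Fin.rev_rev]
  · by_cases h2 : j = Fin.rev s
    · subst h2; rw [spinFlip_apply_right, Fin.rev_rev, spinFlip_apply_left hst, thetaConf_apply, Fin.rev_rev]
    · rw [spinFlip_apply_of_ne h1 h2, thetaConf_apply, spinFlip_apply_of_ne (fun h => h2 (by rw [← h, Fin.rev_rev]))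
        (fun h => h1 (by rw [← h, Fin.rev_rev]))]

/-- **The parity map on the packed configuration** is the packed configuration of the complementary
sector. [folklore] -/
theorem thetaConf_packed (hn : n ≤ L) : thetaConf (packed L n) = packed L (L - n) := by
  funext j
  simp only [thetaConf_apply, packed, Fin.val_rev]
  by_cases h : j.val < L - n
  · rw [decide_eq_true h, decide_eq_false (by omega)]; rfl
  · rw [decide_eq_false h, decide_eq_true (by omega)]; rfl

end Theta

/-! ### Transport of the exchange relations -/

section Transport

variable {q : ℂ} {s t : Fin L} (hst : t.val = s.val + 1)
include hst

/-- The reversed pair is adjacent, in the opposite order. [folklore] -/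
theorem rev_adjacent : (Fin.rev s).val = (Fin.rev t).val + 1 := by
  rw [Fin.val_rev, Fin.val_rev]; omega

/-- **The exchange relations are transported by `Θ` and `ỹ`**: if `Ψ'` satisfies them at the reversed
pair then `σ ↦ ỹ(Ψ'_{Θσ})` satisfies them at `(s, t)`. [cite: HagendorfLienardy2021, Prop. 3.8] -/
theorem isHLExchange_yHom_theta {Ψ' : SpinConfig L → RapidityField ℂ} (h : IsHLExchange q (Fin.rev t) (Fin.rev s) Ψ') :
    IsHLExchange q s t (fun σ => yHom L (Ψ' (thetaConf σ))) := by
  have hne : s ≠ t := fun h' => by rw [h'] at hst; omega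
  have hswap : ∀ x, yHom L (genSwap ℂ ((Fin.rev t).val + 1) x) = genSwap ℂ (s.val + 1) (yHom L x) := fun x => by
    rw [genSwap_yHom (by omega) (by omega), show L - (s.val + 1) = (Fin.rev t).val + 1 by rw [Fin.val_rev]; omega]
  have hzs : yHom L (zv (Fin.rev s)) = (zv s)⁻¹ := by rw [yHom_zv, Fin.rev_rev]
  have hzt : yHom L (zv (Fin.rev t)) = (zv t)⁻¹ := by rw [yHom_zv, Fin.rev_rev]
  have e1 : genC ℂ q * (zv s)⁻¹ / (zv t)⁻¹ = genC ℂ q * zv t / zv s := by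
    field_simp
  have e2 : genC ℂ q * (zv t)⁻¹ / (zv s)⁻¹ = genC ℂ q * zv s / zv t := by
    field_simp
  have e3 : (zv t)⁻¹ / (zv s)⁻¹ = zv s / zv t := by
    field_simp
  refine ⟨fun σ hσ => ?_, fun σ hσ => ?_⟩
  · have h1 := h.1 (thetaConf σ) (by simp only [thetaConf_apply, Fin.rev_rev, hσ])
    have := congrArg (yHom L) h1
    simp only [map_mul, yHom_qbr, map_div₀, yHom_genC, hzs, hzt, hswap] at this
    rw [e1, e2] at this
    exact this
  · have h1 := h.2 (thetaConf σ) (by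
      simp only [thetaConf_apply, Fin.rev_rev, ne_eq, Bool.not_inj_iff]; exact fun h' => hσ h'.symm)
    have := congrArg (yHom L) h1
    simp only [map_add, map_mul, yHom_qbr, map_div₀, yHom_genC, hzs, hzt, hswap] at this
    rw [e1, e3, ← thetaConf_spinFlip hne] at this
    exact this

omit hst in
/-- The exchange relations are stable under multiplication by a swap-invariant scalar. [folklore] -/
theorem IsHLExchange.const_mul {Ψ : SpinConfig L → RapidityField ℂ} (h : IsHLExchange q s t Ψ) {κ : RapidityField ℂ}
    (hκ : genSwap ℂ (s.val + 1) κ = κ) : IsHLExchange q s t (fun σ => κ * Ψ σ) := by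
  refine ⟨fun σ hσ => ?_, fun σ hσ => ?_⟩
  · have := h.1 σ hσ
    rw [map_mul, hκ]
    linear_combination κ * this
  · have := h.2 σ hσ
    rw [map_mul, hκ]
    linear_combination κ * this

end Transport

/-! ### The product of all rapidities -/

section ZvProd

/-- `Π = ∏_j z_j`. [folklore] -/
def zvProd (L : ℕ) : RapidityField ℂ := ∏ j : Fin L, zv j

/-- `Π ≠ 0`. [folklore] -/
theorem zvProd_ne_zero (L : ℕ) : zvProd L ≠ 0 := prod_ne_zero_iff.2 fun j _ => zv_ne_zero j

/-- `Π` is swap invariant. [folklore] -/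
theorem genSwap_zvProd {s t : Fin L} (hst : t.val = s.val + 1) : genSwap ℂ (s.val + 1) (zvProd L) = zvProd L := by
  unfold zvProd
  rw [map_prod]
  simp_rw [genSwap_zv hst]
  exact Fintype.prod_equiv (siteSwap s t) _ _ fun j => rfl

/-- `genInv k` fixes the rapidities of the other sites. [folklore] -/
theorem genInv_zv_of_ne' {k : ℕ} {j : Fin L} (hj : j.val + 1 ≠ k) : genInv ℂ k (zv j) = zv j := by
  unfold zv; rw [genInv_genZ, Function.update_of_ne hj]

/-- `genInv k` inverts the rapidity of the site `k - 1`. [folklore] -/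
theorem genInv_zv_self' {k : ℕ} {j : Fin L} (hj : j.val + 1 = k) : genInv ℂ k (zv j) = (zv j)⁻¹ := by
  unfold zv; rw [genInv_genZ, hj, Function.update_self]

/-- `ι_1 Π⁻¹ = z_1² Π⁻¹`. [folklore] -/
theorem genInv_one_zvProd_inv (hL : 1 ≤ L) :
    genInv ℂ 1 (zvProd L)⁻¹ = zv (⟨0, by omega⟩ : Fin L) ^ 2 * (zvProd L)⁻¹ := by
  have h0 : zv (⟨0, by omega⟩ : Fin L) ≠ 0 := zv_ne_zero _
  unfold zvProd
  rw [map_inv₀, map_prod, ← mul_prod_erase univ _ (mem_univ (⟨0, by omega⟩ : Fin L)),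
    ← mul_prod_erase univ (fun j => zv j) (mem_univ (⟨0, by omega⟩ : Fin L))]
  have hfix : ∀ j ∈ univ.erase (⟨0, by omega⟩ : Fin L), genInv ℂ 1 (zv j) = zv j := fun j hj => by
    refine genInv_zv_of_ne' fun h => ne_of_mem_erase hj (Fin.ext ?_)
    simp; omega
  rw [prod_congr rfl hfix, genInv_zv_self' (k := 1) (j := (⟨0, by omega⟩ : Fin L)) rfl]
  have hP : ∏ j ∈ univ.erase (⟨0, by omega⟩ : Fin L), zv j ≠ 0 := prod_ne_zero_iff.2 fun j _ => zv_ne_zero j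
  field_simp

end ZvProd

/-! ### The special component under `ỹ` -/

section SpecY

variable {q : ℂ} (hq : q ^ 2 + q + 1 = 0)

/-- The reversal of a pair: `(a, b) ↦ (rev b, rev a)`. [folklore] -/
def pairRev (p : Fin L × Fin L) : Fin L × Fin L := (Fin.rev p.2, Fin.rev p.1)

/-- The pair reversal is an involution. [folklore] -/
@[simp] theorem pairRev_pairRev (p : Fin L × Fin L) : pairRev (pairRev p) = p := by
  simp [pairRev]

/-- The pair reversal preserves `pairsLT`. [folklore] -/
theorem pairRev_mem_pairsLT {p : Fin L × Fin L} (hp : p ∈ pairsLT L) : pairRev p ∈ pairsLT L := by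
  rw [mem_pairsLT] at hp ⊢
  exact Fin.rev_lt_rev.2 hp

/-- **Reindexing a product over pairs by the reversal.** [folklore] -/
theorem prod_pairs_rev {M : Type*} [CommMonoid M] (C : Fin L × Fin L → Prop) [DecidablePred C] (g : Fin L × Fin L → M) :
    ∏ p ∈ (pairsLT L).filter C, g (pairRev p) = ∏ p ∈ (pairsLT L).filter (fun p => C (pairRev p)), g p := by
  refine prod_bij' (fun p _ => pairRev p) (fun p _ => pairRev p) (fun p hp => ?_) (fun p hp => ?_) (fun p _ => pairRev_pairRev p)
    (fun p _ => pairRev_pairRev p) (fun p _ => rfl)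
  · rw [mem_filter] at hp ⊢
    exact ⟨pairRev_mem_pairsLT hp.1, by rw [pairRev_pairRev]; exact hp.2⟩
  · rw [mem_filter] at hp ⊢
    exact ⟨pairRev_mem_pairsLT hp.1, hp.2⟩

include hq

/-- `[c/(a b)] = -[c² a b]` (`c³ = 1`). [folklore] -/
theorem qbr_genC_inv_inv (a b : RapidityField ℂ) :
    qbr (genC ℂ q * a⁻¹ * b⁻¹) = -qbr (genC ℂ q ^ 2 * b * a) := by
  have h3 := genC_pow_three hq
  have hci : (genC ℂ q ^ 2)⁻¹ = genC ℂ q := inv_eq_of_mul_eq_one_right (by rw [← pow_succ]; exact h3)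
  rw [← qbr_inv, mul_inv, mul_inv, hci]
  ring_nf

/-- `[c²/(a b)] = -[c a b]` (`c³ = 1`). [folklore] -/
theorem qbr_genC_sq_inv_inv (a b : RapidityField ℂ) :
    qbr (genC ℂ q ^ 2 * a⁻¹ * b⁻¹) = -qbr (genC ℂ q * b * a) := by
  have h3 := genC_pow_three hq
  have hci : (genC ℂ q)⁻¹ = genC ℂ q ^ 2 := inv_eq_of_mul_eq_one_right (by rw [← pow_succ']; exact h3)
  rw [← qbr_inv, mul_inv, mul_inv, hci]
  ring_nf

omit hq in
/-- `[c b⁻¹/a⁻¹] = [c a/b]`. [folklore] -/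
theorem qbr_genC_inv_div_inv (a b : RapidityField ℂ) : qbr (genC ℂ q * b⁻¹ / a⁻¹) = qbr (genC ℂ q * a / b) := by
  congr 1; rw [div_inv_eq_mul, div_eq_mul_inv]; ring

/-- **The special-component factors under `ỹ`**, first kind: `ỹ([c z_b/z_a][c z_a z_b]) = -[c z_{b'}/z_{a'}][c² z_{a'} z_{b'}]`
with `(a', b')` the reversed pair. [folklore] -/
theorem yHom_specFactor (p : Fin L × Fin L) :
    yHom L (qbr (genC ℂ q * zv p.2 / zv p.1) * qbr (genC ℂ q * zv p.1 * zv p.2)) =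
      -(qbr (genC ℂ q * zv (pairRev p).2 / zv (pairRev p).1) * qbr (genC ℂ q ^ 2 * zv (pairRev p).1 * zv (pairRev p).2)) := by
  rw [map_mul, yHom_qbr, yHom_qbr, map_div₀, map_mul, map_mul, map_mul, yHom_genC, yHom_zv, yHom_zv]
  simp only [pairRev]
  rw [qbr_genC_inv_div_inv, qbr_genC_inv_inv hq]
  ring

/-- The same, second kind: `ỹ([c z_b/z_a][c² z_a z_b]) = -[c z_{b'}/z_{a'}][c z_{a'} z_{b'}]`. [folklore] -/
theorem yHom_prefFactor (p : Fin L × Fin L) :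
    yHom L (qbr (genC ℂ q * zv p.2 / zv p.1) * qbr (genC ℂ q ^ 2 * zv p.1 * zv p.2)) =
      -(qbr (genC ℂ q * zv (pairRev p).2 / zv (pairRev p).1) * qbr (genC ℂ q * zv (pairRev p).1 * zv (pairRev p).2)) := by
  rw [map_mul, yHom_qbr, yHom_qbr, map_div₀, map_mul, map_mul, map_mul, map_pow, yHom_genC, yHom_zv, yHom_zv]
  simp only [pairRev]
  rw [qbr_genC_inv_div_inv, qbr_genC_sq_inv_inv hq]
  ring

omit hq in
/-- The reversed filters, first kind. [folklore] -/
theorem filter_snd_lt_rev {n n' : ℕ} (hnn : n + n' = L) :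
    (pairsLT L).filter (fun p => (pairRev p).2.val < n') = (pairsLT L).filter (fun p => ¬p.1.val < n) := by
  refine filter_congr fun p _ => ?_
  simp only [pairRev, Fin.val_rev]
  omega

omit hq in
/-- The reversed filters, second kind. [folklore] -/
theorem filter_not_fst_lt_rev {n n' : ℕ} (hnn : n + n' = L) :
    (pairsLT L).filter (fun p => ¬(pairRev p).1.val < n') = (pairsLT L).filter (fun p => p.2.val < n) := by
  refine filter_congr fun p _ => ?_
  simp only [pairRev, Fin.val_rev]
  omega

omit hq in
/-- The reversal maps the first `n'` sites onto the last `n' = L - n`. [folklore] -/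
theorem prod_sLT_rev {M : Type*} [CommMonoid M] {n n' : ℕ} (hnn : n + n' = L) (g : Fin L → M) :
    ∏ i ∈ sLT L n', g (Fin.rev i) = ∏ j ∈ univ.filter (fun j : Fin L => ¬j.val < n), g j := by
  refine prod_bij' (fun i _ => Fin.rev i) (fun j _ => Fin.rev j) (fun i hi => ?_) (fun j hj => ?_) (fun i _ => Fin.rev_rev i)
    (fun j _ => Fin.rev_rev j) (fun i _ => rfl)
  · rw [mem_sLT] at hi; simp only [mem_filter, mem_univ, true_and, Fin.val_rev]; omega
  · simp only [mem_filter, mem_univ, true_and] at hj; rw [mem_sLT, Fin.val_rev]; omega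

/-- The sign relating the two special components. [folklore] -/
def signTheta (L n n' : ℕ) : RapidityField ℂ :=
  (-1) ^ (n + n' + ((pairsLT L).filter (fun p => p.2.val < n')).card + ((pairsLT L).filter (fun p => ¬p.1.val < n')).card)

omit hq in
/-- The sign squares to one. [folklore] -/
theorem signTheta_sq (L n n' : ℕ) : signTheta L n n' * signTheta L n n' = 1 := by
  unfold signTheta; rw [← pow_add, ← two_mul, pow_mul, neg_one_sq, one_pow]

omit hq in
/-- The sign is invariant under every ring homomorphism fixing `1`. [folklore] -/
theorem map_signTheta {F : Type*} [FunLike F (RapidityField ℂ) (RapidityField ℂ)] [RingHomClass F (RapidityField ℂ) (RapidityField ℂ)]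
    (φ : F) (L n n' : ℕ) : φ (signTheta L n n') = signTheta L n n' := by
  simp [signTheta, map_pow, map_neg, map_one]

/-- **The special component under `ỹ`**: `ỹ(Ψ'_{σ⁰'}) = ± Π Ψ_{σ⁰}` for the complementary sectors
`n + n' = L`. [cite: HagendorfLienardy2021, Prop. 3.1, (3.21)] -/
theorem yHom_vPsi_spec {n n' : ℕ} (hnn : n + n' = L) :
    yHom L (vPsi q L n' (Fin.castLE (by omega))) = signTheta L n n' * zvProd L * vPsi q L n (Fin.castLE (by omega)) := by
  rw [vPsi_spec hq (by omega : n' ≤ L), vPsi_spec hq (by omega : n ≤ L)]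
  unfold specRHS
  rw [map_mul, map_mul, map_mul, map_pow, map_neg, map_one, map_prod, map_prod, map_prod]
  -- the three transformed products
  have T1 : ∏ p ∈ (pairsLT L).filter (fun p => p.2.val < n'), yHom L (qbr (genC ℂ q * zv p.2 / zv p.1) * qbr (genC ℂ q * zv p.1 * zv p.2)) =
      (-1) ^ ((pairsLT L).filter (fun p => p.2.val < n')).card *
        ∏ p ∈ (pairsLT L).filter (fun p => ¬p.1.val < n), qbr (genC ℂ q * zv p.2 / zv p.1) * qbr (genC ℂ q ^ 2 * zv p.1 * zv p.2) := by
    rw [prod_congr rfl fun p _ => yHom_specFactor hq p, prod_neg, ← filter_snd_lt_rev hnn,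
      ← prod_pairs_rev (fun p => p.2.val < n') (fun p => qbr (genC ℂ q * zv p.2 / zv p.1) * qbr (genC ℂ q ^ 2 * zv p.1 * zv p.2))]
  have T2 : ∏ i ∈ sLT L n', yHom L (zv i)⁻¹ = ∏ j ∈ univ.filter (fun j : Fin L => ¬j.val < n), zv j := by
    rw [← prod_sLT_rev hnn]
    exact prod_congr rfl fun i _ => by rw [map_inv₀, yHom_zv, inv_inv]
  have T3 : ∏ p ∈ (pairsLT L).filter (fun p => ¬p.1.val < n'), yHom L (qbr (genC ℂ q * zv p.2 / zv p.1) * qbr (genC ℂ q ^ 2 * zv p.1 * zv p.2)) =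
      (-1) ^ ((pairsLT L).filter (fun p => ¬p.1.val < n')).card *
        ∏ p ∈ (pairsLT L).filter (fun p => p.2.val < n), qbr (genC ℂ q * zv p.2 / zv p.1) * qbr (genC ℂ q * zv p.1 * zv p.2) := by
    rw [prod_congr rfl fun p _ => yHom_prefFactor hq p, prod_neg, ← filter_not_fst_lt_rev hnn,
      ← prod_pairs_rev (fun p => ¬p.1.val < n') (fun p => qbr (genC ℂ q * zv p.2 / zv p.1) * qbr (genC ℂ q * zv p.1 * zv p.2))]
  have T4 : zvProd L = (∏ i ∈ sLT L n, zv i) * ∏ j ∈ univ.filter (fun j : Fin L => ¬j.val < n), zv j := by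
    unfold zvProd sLT; rw [prod_filter_mul_prod_filter_not]
  have T5 : ∏ i ∈ sLT L n, (zv i)⁻¹ = (∏ i ∈ sLT L n, zv i)⁻¹ := prod_inv_distrib _
  have hB : ∏ i ∈ sLT L n, zv i ≠ 0 := prod_ne_zero_iff.2 fun i _ => zv_ne_zero i
  rw [T1, T2, T3, T4, T5]
  unfold signTheta
  generalize ∏ p ∈ (pairsLT L).filter (fun p => ¬p.1.val < n), qbr (genC ℂ q * zv p.2 / zv p.1) * qbr (genC ℂ q ^ 2 * zv p.1 * zv p.2) = A
  generalize ∏ j ∈ univ.filter (fun j : Fin L => ¬j.val < n), zv j = B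
  generalize ∏ p ∈ (pairsLT L).filter (fun p => p.2.val < n), qbr (genC ℂ q * zv p.2 / zv p.1) * qbr (genC ℂ q * zv p.1 * zv p.2) = C
  generalize ∏ i ∈ sLT L n, zv i = D at hB ⊢
  have hsq : ((-1 : RapidityField ℂ) ^ n) ^ 2 = 1 := by rw [← pow_mul, mul_comm, pow_mul, neg_one_sq, one_pow]
  generalize ((pairsLT L).filter (fun p => p.2.val < n')).card = a
  generalize ((pairsLT L).filter (fun p => ¬p.1.val < n')).card = b
  rw [show ((-1 : RapidityField ℂ)) ^ (n + n' + a + b) * (D * B) * ((-1) ^ n * C * D⁻¹ * A) =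
    (-1) ^ (n + n' + a + b) * (-1) ^ n * A * B * C * (D * D⁻¹) by ring, mul_inv_cancel₀ hB, mul_one, pow_add, pow_add, pow_add]
  linear_combination (-((-1) ^ n' * (-1) ^ a * (-1) ^ b * A * B * C)) * hsq

end SpecY

/-! ### The vector from the complementary sector, and the left reflection relation -/

section LeftReflection

variable {q : ℂ} (hq : q ^ 2 + q + 1 = 0)
include hq

/-- **`Ψ = ± Π⁻¹ ỹ(Ψ' ∘ Θ)`** on the sector with `n` down spins, `Ψ'` the vector of the sector with
`n' = L - n` down spins (uniqueness of HL Prop. 3.5 applied to both sides). [cite: HagendorfLienardy2021, Prop. 3.5, Prop. 3.8] -/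
theorem vPsiVec_eq_theta {n n' : ℕ} (hnn : n + n' = L) :
    ∀ σ : SpinConfig L, downCount σ = n →
      vPsiVec q L n σ = signTheta L n n' * (zvProd L)⁻¹ * yHom L (vPsiVec q L n' (thetaConf σ)) := by
  refine eq_of_isHLExchange_of_spec_eq hq (fun s t hst => isHLExchange_vPsiVec hq hst) (fun s t hst => ?_) ?_
  · have h := isHLExchange_yHom_theta hst (isHLExchange_vPsiVec (q := q) (n := n') hq (rev_adjacent hst))
    have := IsHLExchange.const_mul h (κ := signTheta L n n' * (zvProd L)⁻¹)
      (by rw [map_mul, map_signTheta, map_inv₀, genSwap_zvProd hst])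
    simpa [mul_assoc] using this
  · rw [thetaConf_packed (by omega), show L - n = n' by omega, vPsiVec_packed q (by omega : n' ≤ L), yHom_vPsi_spec hq hnn,
      vPsiVec_packed q (by omega : n ≤ L)]
    have h1 := signTheta_sq L n n'
    have h2 := zvProd_ne_zero L
    field_simp
    linear_combination -(vPsi q L n (Fin.castLE (by omega))) * h1

/-- **The left reflection relation** (HL (3.27) at `β → 0`, `s = 1`): on the sector with `n` down spins
of `L` sites, `1 ≤ n`, `L ≤ 2n + 1`: `ι_1 Ψ_σ = z_1² Ψ_σ` if the first spin is down and `ι_1 Ψ_σ = Ψ_σ`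
if it is up. [cite: HagendorfLienardy2021, Prop. 3.8, (3.37)–(3.38)] -/
theorem genInv_one_vPsiVec {L' n : ℕ} (hn : 1 ≤ n) (hnL : n ≤ L' + 1) (hL : L' ≤ 2 * n) (σ : SpinConfig (L' + 1))
    (hσ : downCount σ = n) :
    genInv ℂ 1 (vPsiVec q (L' + 1) n σ) =
      (if σ ⟨0, by omega⟩ = true then zv (⟨0, by omega⟩ : Fin (L' + 1)) ^ 2 else 1) * vPsiVec q (L' + 1) n σ := by
  set n' := L' + 1 - n with hn'
  have hnn : n + n' = L' + 1 := by omega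
  have hrev0 : Fin.rev (Fin.last L') = (⟨0, by omega⟩ : Fin (L' + 1)) := Fin.ext (by simp)
  have hθlast : thetaConf σ (Fin.last L') = !σ ⟨0, by omega⟩ := by rw [thetaConf_apply, hrev0]
  have hθcount : downCount (thetaConf σ) = n' := by have := downCount_thetaConf σ; omega
  rw [vPsiVec_eq_theta hq hnn σ hσ, map_mul, map_mul, map_signTheta, genInv_one_yHom (by omega), genInv_one_zvProd_inv (by omega)]
  by_cases h0 : σ ⟨0, by omega⟩ = true
  · -- first spin down: the last spin of `Θσ` is up, `ι_L Ψ' = Ψ'`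
    have hup : thetaConf σ ⟨L' + 1 - 1, by omega⟩ = false := by
      rw [show (⟨L' + 1 - 1, by omega⟩ : Fin (L' + 1)) = Fin.last L' from Fin.ext (by simp), hθlast, h0]; rfl
    rw [if_pos h0, genInv_vPsiVec_of_last_up hq (by omega : n' < L' + 1) _ hθcount hup]
    ring
  · -- first spin up: the last spin of `Θσ` is down, `ι_L Ψ' = z_L² Ψ'`
    have hdown : thetaConf σ (Fin.last L') = true := by
      rw [hθlast]; cases h' : σ ⟨0, by omega⟩
      · rfl
      · exact absurd h' h0
    have hpos : 0 < downCount (thetaConf σ) := by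
      unfold downCount; exact Finset.card_pos.2 ⟨Fin.last L', mem_filter.2 ⟨mem_univ _, hdown⟩⟩
    obtain ⟨n'', hn''⟩ : ∃ n'', n' = n'' + 1 := ⟨n' - 1, by omega⟩
    have hθcount' : downCount (thetaConf σ) = n'' + 1 := by rw [← hn'']; exact hθcount
    rw [if_neg h0, hn'', genInv_vPsiVec_of_last_down hq (by omega : 2 * n'' ≤ L') _ hθcount' hdown, map_mul, map_pow, yHom_zv,
      hrev0]
    have h00 : zv (⟨0, by omega⟩ : Fin (L' + 1)) ≠ 0 := zv_ne_zero _
    field_simp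

end LeftReflection

end Literature.Probability.Percolation
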